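import Summits.Parity.GeneralizedHardyLittlewood.Theses.LeeYangFibres
import Summits.Parity.GeneralizedHardyLittlewood.Theorems.PrimeCellsRelative.Negative.FalseWithoutAbsoluteError
import Summits.Parity.GeneralizedHardyLittlewood.Theorems.PrimeCellsRelative.Negative.FalseWithoutSizeBound
import Summits.Parity.GeneralizedHardyLittlewood.Theorems.PrimeCellsRelative.Negative.FalseWithoutNondegeneracy
import Summits.Parity.GeneralizedHardyLittlewood.Theorems.PrimeCellsRelative.Negative.FalseWithoutBoxContainment
import Summits.Parity.GeneralizedHardyLittlewood.Theorems.PrimeCellsRelative.Negative.FalseWithoutConvexity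
import Summits.Parity.GeneralizedHardyLittlewood.Theorems.PrimeCellsRelative.Negative.SlackAtZero
import Summits.Parity.GeneralizedHardyLittlewood.Theorems.LeeYangFibresPrimeCellsRelativeLocator
import Summits.Parity.GeneralizedHardyLittlewood.Theorems.LeeYangFibresPrimeCellsRelativeHardness
import HarnessLib

/-!
# Disproof of `PrimeCellsRelative` (crux stmt-Parity-14112, route `LeeYangFibres`) — findings of
# the standing adversary (refuter cdisprove seat, cycle 1, 2026-08-16)

The crux (rank 9, "crux by grade", a derived NODE of the route): for all `t ≥ 1`, `L`, `ε > 0`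
there are `u ≥ 2`, `N₀` with, for `N ≥ N₀`, uniformly over non-degenerate `d = 1` systems `Ψ` of
`t` forms with `‖Ψ‖_N ≤ L` and convex `K ⊆ [-N, N]`,
`|#{n ∈ K ∩ ℤ : every ψᵢ(n) a prime > N^{1/u}} − M₁| ≤ ε (M₁ + N / log^t N)`,
`M₁ = β_∞(Ψ, K) · 𝔖(Ψ) · (A₁(N)/N)^t`, `A₁(N) = π(N) − π(N^{1/u})` — counting Dickson–Hardy–Littlewood
with Green–Tao's Conj. 1.4 error shape.

**Verdict: NO KILL, and none is available short of disproving the summit.** Kernel-checked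
bracket (provers' files, all ACCEPTED, cited not re-proved):
`GeneralizedHardyLittlewood ⟹ DimOne ⟹ PrimeCellsRelative ⟺ RelativeDimOne ⟹ TwinPrimeConjecture`
(`Cruxes.PrimeCellsRelative.Sketch.primeCellsRelative_of_generalizedHardyLittlewood`,
`…primeCellsRelative_iff_relativeDimOne`, `…primeCellsRelative_implies_twinPrimeConjecture`,
p89136) and `PrimeCellsRelative ⟹ UniformCharPNT`, `MatomakiMerikoski2023_pairCorrelation ⟹
PrimeCellsRelative ⟹ ¬ UnboundedSiegelZeros` (p96058). So `¬ PrimeCellsRelative` would refute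
Green–Tao Conj. 1.2 at `d = 1` (the audited Statement's `DimOne` slice): the only route to falsity
in print is a sufficiently strong family of Siegel zeros (Matomäki–Merikoski 2023, Thm 1.3), which
nobody can exhibit. The `t = 1` slice is a THEOREM (`…primeCellsRelative_at_one`). What this seat
CAN and does prove is which hypotheses / error terms of the typing are load-bearing — each
one-ingredient-deleted variant below is FALSE, sorry-free — i.e. what any proof must use and what
no re-typing may drop. Prose lives in docstrings; the file is sorry-free.

## Index

(a) LOAD-BEARING INGREDIENTS (the crux with one ingredient deleted is FALSE; `def …Without<H>` +
`theorem primeCellsRelative_false_without_<H>`; each also LANDED stand-alone under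
`Theorems/PrimeCellsRelative/Negative/`):
* `PrimeCellsRelativeWithoutAbsoluteError` — the `+ N/log^t N` term deleted (pure relative
  accuracy): FALSE — one-point body `K = {P}`, `P` a Bertrand prime in `(N/2, N]`, `ψ(n) = n`:
  count `1`, `β_∞ = 0`. LANDED `Negative/FalseWithoutAbsoluteError.lean` (p98015, ACCEPTED;
  re-exported here). ⇒ thin / small bodies can only be controlled through the absolute term;
  relative accuracy needs main-term mass.
* `PrimeCellsRelativeWithoutSizeBound` — `‖Ψ‖_N ≤ L` deleted (equivalently `N₀` chosen before
  `L`): FALSE — `ψ(n) = n + b_N`, `b_N = (2N+2)! + N + 2`, `K = [-N, N]`: EMPTY prime cell (each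
  value a proper multiple of `n + N + 2 ∈ [2, 2N+2]`) against the model `2 A₁(N) ≍ 2N/log N`
  (`𝔖 = 1`, `β_∞ = 2N`). LANDED `Negative/FalseWithoutSizeBound.lean` (p99402, ACCEPTED). ⇒ shift-uniformity only
  for `|b| ≤ L N` with `N₀` after `L` (prime-free windows of length `2N+1` at height `(2N+2)!`).
* `PrimeCellsRelativeWithoutNondegeneracy` — `IsNondegenerateSystem Ψ` deleted: FALSE for the
  DIAGONAL `(n, n)` (`t = 2`), for EVERY real value `𝔖` of its divergent (junk `limUnder`) singular
  product: count `≥ A₁(N)`, model `𝔖 A₁²/N ≤ A₁/2` once `log N > 3𝔖`. LANDED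
  `Negative/FalseWithoutNondegeneracy.lean` (p99898, ACCEPTED). ⇒ proportional forms must be excluded by the
  mechanism itself; no normalisation of `𝔖` repairs the diagonal.
* `PrimeCellsRelativeWithoutBoxContainment` — `K ⊆ [-N, N]` deleted: FALSE — `ψ(n) = n`,
  `K = [2N, 10N]`: count `0`, `β_∞ = 8N`. LANDED `Negative/FalseWithoutBoxContainment.lean` (p100396, ACCEPTED).
  ⇒ `β_∞` is computed on `K ∩ [-N, N]`; enlarged bodies must be clipped back before invoking it.
* `PrimeCellsRelativeWithoutConvexity` — `Convex ℝ K` deleted: FALSE — `ψ(n) = n`,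
  `K = [-N, N] ∖ {prime points}`: count `0`, `β_∞ = N` (countable sets are null). LANDED
  `Negative/FalseWithoutConvexity.lean` (p100495, ACCEPTED). ⇒ the main term sees `K` through its measure, the count
  through its lattice points; only (boundedly many) intervals reconcile them.
All five use only Bertrand (Mathlib) or the prime number theorem window
`N/2 ≤ A₁(N) log N ≤ 3N/2` (tree: `Theorems.LeeYangFibresCells.eventually_primeCounting_window`,
from `Literature.NumberTheory.LFunctions.primeCounting_isEquivalent_holds`) plus
`OneForm.singularProduct_eq` (`𝔖(an+b) = 𝟙_{(a,b)=1}|a|/φ(|a|)`) and `DimOne.archFactor_eq`.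

(b) NOT load-bearing / slack (information for provers and planners):
* `1 ≤ t`: decorative — PROVED below (`primeCellsRelative_at_zero`, (b); LANDED stand-alone as
  `Negative/SlackAtZero.lean`, p100967): at `t = 0` the statement reads `|#(K ∩ ℤ) − vol K · 𝔖(∅)| ≤ ε (vol K + N)`
  with `𝔖(∅) = 1`, true for `N ≥ 1/ε` since `|#(K ∩ ℤ) − vol K| ≤ 1` on an interval
  (`DimOne.exists_filter_eq_Icc`). So any counterexample needs `t ≥ 2` (`t = 1` is a theorem).
* the roughness cut `prime > N^{1/u}` and `A₁(N)` versus `π(N)`: cosmetic at this error scale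
  (they change count and model by `≤ t N^{1/2}` resp. a factor `1 + O(N^{-1/2})`), as the provers'
  up/down transfers `stub_upTransfer` / `cellsToRelativeDimOne_proof` confirm (conjecturally every
  `u ≥ 2` works; the transfer produces some `u`).
* `(A₁(N)/N)^t` versus `1/log^t N` or `∏ᵢ 1/log ψᵢ(n)`: equivalent by PNT and because values
  `ψᵢ(n) ≤ N^{1-η}` occupy `≤ 2t N^{1-η}` points `n` (absorbed by the absolute term) while on the
  rest `log ψᵢ(n) = (1 + O(η + log L/log N)) log N` — checked on paper symbol by symbol; this is the
  sandwich the provers formalised in `LeeYangFibresPrimeCellsRelativeUpTransfer`.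

(c) NATURAL STRENGTHENINGS: pure relative error — FALSE ((a), absolute term); `N₀` uniform in
`L` — FALSE ((a), size bound); pure ABSOLUTE error `ε N/log^t N` = the counting form of `DimOne`
— open, and `(relative+absolute) ⟹ absolute` is exactly the complementary-sector crux
`AbsoluteUpgrade` (stmt-Parity-14116; its high-mass core `absoluteUpgrade_iff_highMass`); `∀ u ≥ 2`
in place of `∃ u` — open (conjecturally true, implied by `DimOne` through the same transfer);
uniformity in `t` or `L → ∞` with `N` — the `L`-direction is false by (a), the `t`-direction open.

(d) TARGETS (lead's stuck stubs): none registered (`stuck_stubs = []`). The picked line `Sketch`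
has ONE open stub, `stub_relativeDimOne_two_le` = item stmt-Parity-14113 restricted to `t ≥ 2`,
which is EQUIVALENT to the crux (`stub_iff_primeCellsRelative` in `Lines/Sketch.lean`): not
attackable short of `¬`(uniform Hardy–Littlewood), see the verdict.

(e) NEAR-MISSES: none kept. The conditional negative "`UnboundedSiegelZeros ∧
MatomakiMerikoski2023_pairCorrelation → ¬ PrimeCellsRelative`" is the contrapositive of the landed
guard `primeCellsRelative_not_unboundedSiegelZeros` (re-exported below as
`primeCellsRelative_false_of_unboundedSiegelZeros`); it is NOT filed `--negative-modulo` (its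
hypothesis is believed false, so holding the item on it would be perverse).

(f) SEARCHES / CHEAP ATTACKS RUN (numbers, not adjectives): signature elaborates (rc 0, farm);
`simp / decide / aesop` cannot touch a `∃ u ∃ N₀ ∀ N` statement (not tried beyond elaboration);
hypotheses satisfiable (twin system, `‖·‖_N ≤ 3`); degenerate instances: `t = 0` true (b), `K = ∅`
and `K = {pt}` consistent WITH the absolute term, false without it (a); `(n, n+1)` (local
obstruction, `𝔖 = 0`, count `0` for `N ≥ 2^u`) consistent; degenerate systems: `(n, n)`
inconsistent for EVERY junk value of `𝔖` (a), whereas `(n, 2n)`, `(n, −n)` and the constant forms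
`ψ = 1`, `ψ = 3` have count `0` (roughness cut / no prime values) and are consistent iff their junk
resp. obstructed `𝔖` vanishes — so on the counting side only the non-proportionality clause of
`IsNondegenerateSystem` is provably load-bearing, the clause `ψ̇ ≠ 0` is not (contrast: on the
Λ-side `ψ = 3` kills, `relativeDimOne_false_without_nondegenerate`); value-scale check `ψᵢ(n) ≤ L N`
versus model density at scale `N`: relative discrepancy `log L/log N → 0` (consistent); short /
far bodies: absorbed by the absolute term (consistent). Literature: Friedlander–Granville
uniformity barrier (`Literature.Barriers.Parity.FriedlanderGranvilleUniformity`) bites only for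
moduli `q → ∞` (`q > x/log^B x`), here `|a| ≤ L` — not applicable; Maier-type irregularities live
at interval length `(log N)^λ ≪ N/log^t N` — below the absolute term; Siegel-zero route — see
verdict. `ledger negatives --problem Parity`: no entry on this node. Barrier catalogue
(`SelbergParityBarrier`, `PrimePairParity`, `FordFixedLevel`, `SiegelZeroPrimePairs`): obstruct
PROOFS by sieve / distribution inputs, say nothing about falsity.

(g) SIBLING NODE. The crux is ONE node with `RelativeDimOne` (stmt-Parity-14113); the Λ-side
load-bearing analysis of that node by its own cdisprove seat is LANDED under
`Theorems/RelativeDimOne/Negative/` (`relativeDimOne_false_without_{size,box,convex,nondegenerate,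
nonproportional,epsPos,threshold}`, `not_purelyRelativeDimOne`, `not_relativeDimOneLogSlack`,
`relativeDimOneAtZero_holds`, `relativeDimOneUniformInT_iff`). The present file is the COUNTING-side
counterpart (different statements: cells, `A₁(N)`, `N/log^t N`), with two differences worth a
planner's attention: (i) on the counting side a one-point body kills only the pure-relative variant,
not a `log`-power absolute slack (count `1` versus `ε log^A N`): the quantitative floor for the absolute
term here is Maier's theorem (intervals of length `log^A N` carry `(1 ± δ_A)`-biased prime counts, so an
absolute slack `ε g(N)` needs `g(N)/log^A N → ∞` for every `A`) — prose only, out of formal reach;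
(ii) uniformity of `N₀` in `t` is NOT automatic here (the `∃ u` depends on `t`; `‖Ψ‖_N ≥ t` still
bounds `t ≤ L`, but the `u`'s of different `t ≤ L` need not agree unless every `u ≥ 2` works).
-/

noncomputable section

namespace Summit.Parity.GeneralizedHardyLittlewood.Cruxes.PrimeCellsRelative.Disproof

open scoped BigOperators Topology Classical MeasureTheory
open Filter Set Function MeasureTheory Finset Literature.NumberTheory.Sieve
open Summit.Parity.GeneralizedHardyLittlewood.Theses.LeeYangFibres (PrimeCellsRelative)
open Summit.Parity.GeneralizedHardyLittlewood.Theorems.PrimeCellsRelative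

/-! ## (a) Load-bearing ingredients -/

/-! ### The absolute error term `N / log^t N` -/

/-- `PrimeCellsRelative` with the absolute error term `+ N / log^t N` deleted (pure relative
accuracy `ε M₁`). FALSE: `primeCellsRelative_false_without_absoluteError`. -/
def PrimeCellsRelativeWithoutAbsoluteError : Prop :=
  ∀ (t L : ℕ), 1 ≤ t → ∀ ε : ℝ, 0 < ε → ∃ u : ℕ, 2 ≤ u ∧ ∃ N₀ : ℕ, ∀ N : ℕ, N₀ ≤ N →
      ∀ Ψ : Fin t → Literature.NumberTheory.Sieve.AffLinForm 1,
        Literature.NumberTheory.Sieve.IsNondegenerateSystem Ψ →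
        Literature.NumberTheory.Sieve.affLinSize Ψ N ≤ L →
        ∀ K : Set (Fin 1 → ℝ), Convex ℝ K → K ⊆ Literature.NumberTheory.Sieve.realBox 1 N →
          |((((Literature.NumberTheory.Sieve.latticeBox 1 N).filter (fun n =>
              Literature.NumberTheory.Sieve.realPoint n ∈ K ∧ ∀ i, (N : ℝ) ^ ((1 : ℝ) / u) <
                (Nat.minFac ((Ψ i).eval n).toNat : ℝ) ∧
                ArithmeticFunction.cardFactors ((Ψ i).eval n).toNat = 1)).card : ℕ) : ℝ) -
            Literature.NumberTheory.Sieve.archFactor Ψ K *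
              Literature.NumberTheory.Sieve.singularProduct Ψ *
              (((((Finset.Icc 1 N).filter (fun m => (N : ℝ) ^ ((1 : ℝ) / u) < (Nat.minFac m : ℝ) ∧
                ArithmeticFunction.cardFactors m = 1)).card : ℕ) : ℝ) / N) ^ t| ≤
          ε * (Literature.NumberTheory.Sieve.archFactor Ψ K *
              Literature.NumberTheory.Sieve.singularProduct Ψ *
              (((((Finset.Icc 1 N).filter (fun m => (N : ℝ) ^ ((1 : ℝ) / u) < (Nat.minFac m : ℝ) ∧
                ArithmeticFunction.cardFactors m = 1)).card : ℕ) : ℝ) / N) ^ t)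

/-- **Any proof must use the absolute term** (LANDED: `Negative/FalseWithoutAbsoluteError.lean`,
p98015): the pure-relative variant is false — singleton body at a Bertrand prime. -/
theorem primeCellsRelative_false_without_absoluteError : ¬ PrimeCellsRelativeWithoutAbsoluteError :=
  Theorems.PrimeCellsRelative.Negative.primeCellsRelative_false_without_absoluteError

/-! ### The size bound `‖Ψ‖_N ≤ L` -/

/-- `PrimeCellsRelative` with the size hypothesis `affLinSize Ψ N ≤ L` deleted (so `L` disappears;
equivalently, `N₀` may not depend on `L`). FALSE: `primeCellsRelative_false_without_sizeBound`. -/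
def PrimeCellsRelativeWithoutSizeBound : Prop :=
  ∀ t : ℕ, 1 ≤ t → ∀ ε : ℝ, 0 < ε → ∃ u : ℕ, 2 ≤ u ∧ ∃ N₀ : ℕ, ∀ N : ℕ, N₀ ≤ N →
      ∀ Ψ : Fin t → Literature.NumberTheory.Sieve.AffLinForm 1,
        Literature.NumberTheory.Sieve.IsNondegenerateSystem Ψ →
        ∀ K : Set (Fin 1 → ℝ), Convex ℝ K → K ⊆ Literature.NumberTheory.Sieve.realBox 1 N →
          |((((Literature.NumberTheory.Sieve.latticeBox 1 N).filter (fun n =>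
              Literature.NumberTheory.Sieve.realPoint n ∈ K ∧ ∀ i, (N : ℝ) ^ ((1 : ℝ) / u) <
                (Nat.minFac ((Ψ i).eval n).toNat : ℝ) ∧
                ArithmeticFunction.cardFactors ((Ψ i).eval n).toNat = 1)).card : ℕ) : ℝ) -
            Literature.NumberTheory.Sieve.archFactor Ψ K *
              Literature.NumberTheory.Sieve.singularProduct Ψ *
              (((((Finset.Icc 1 N).filter (fun m => (N : ℝ) ^ ((1 : ℝ) / u) < (Nat.minFac m : ℝ) ∧
                ArithmeticFunction.cardFactors m = 1)).card : ℕ) : ℝ) / N) ^ t| ≤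
          ε * (Literature.NumberTheory.Sieve.archFactor Ψ K *
              Literature.NumberTheory.Sieve.singularProduct Ψ *
              (((((Finset.Icc 1 N).filter (fun m => (N : ℝ) ^ ((1 : ℝ) / u) < (Nat.minFac m : ℝ) ∧
                ArithmeticFunction.cardFactors m = 1)).card : ℕ) : ℝ) / N) ^ t + N / Real.log N ^ t)

/-- **Any proof must use the size bound** (LANDED: `Negative/FalseWithoutSizeBound.lean`, p99402):
prime-free windows of length `2N+1` at height `(2N+2)!` — `ψ(n) = n + (2N+2)! + N + 2` on `[-N, N]`
has an empty prime cell against the model `2 A₁(N)`. -/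
theorem primeCellsRelative_false_without_sizeBound : ¬ PrimeCellsRelativeWithoutSizeBound :=
  Negative.primeCellsRelative_false_without_sizeBound

/-! ### Non-degeneracy -/

/-- `PrimeCellsRelative` with `IsNondegenerateSystem Ψ` deleted. FALSE (diagonal system, any junk
value of `𝔖`): `primeCellsRelative_false_without_nondegeneracy`. -/
def PrimeCellsRelativeWithoutNondegeneracy : Prop :=
  ∀ (t L : ℕ), 1 ≤ t → ∀ ε : ℝ, 0 < ε → ∃ u : ℕ, 2 ≤ u ∧ ∃ N₀ : ℕ, ∀ N : ℕ, N₀ ≤ N →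
      ∀ Ψ : Fin t → Literature.NumberTheory.Sieve.AffLinForm 1,
        Literature.NumberTheory.Sieve.affLinSize Ψ N ≤ L →
        ∀ K : Set (Fin 1 → ℝ), Convex ℝ K → K ⊆ Literature.NumberTheory.Sieve.realBox 1 N →
          |((((Literature.NumberTheory.Sieve.latticeBox 1 N).filter (fun n =>
              Literature.NumberTheory.Sieve.realPoint n ∈ K ∧ ∀ i, (N : ℝ) ^ ((1 : ℝ) / u) <
                (Nat.minFac ((Ψ i).eval n).toNat : ℝ) ∧
                ArithmeticFunction.cardFactors ((Ψ i).eval n).toNat = 1)).card : ℕ) : ℝ) -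
            Literature.NumberTheory.Sieve.archFactor Ψ K *
              Literature.NumberTheory.Sieve.singularProduct Ψ *
              (((((Finset.Icc 1 N).filter (fun m => (N : ℝ) ^ ((1 : ℝ) / u) < (Nat.minFac m : ℝ) ∧
                ArithmeticFunction.cardFactors m = 1)).card : ℕ) : ℝ) / N) ^ t| ≤
          ε * (Literature.NumberTheory.Sieve.archFactor Ψ K *
              Literature.NumberTheory.Sieve.singularProduct Ψ *
              (((((Finset.Icc 1 N).filter (fun m => (N : ℝ) ^ ((1 : ℝ) / u) < (Nat.minFac m : ℝ) ∧
                ArithmeticFunction.cardFactors m = 1)).card : ℕ) : ℝ) / N) ^ t + N / Real.log N ^ t)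

/-- **Any proof must use non-degeneracy, whatever `𝔖` of the diagonal is** (LANDED:
`Negative/FalseWithoutNondegeneracy.lean`, p99898): `Ψ = (n, n)`, `K = [-N, N]`, count `≥ A₁(N)`
versus `𝔖 A₁²/N ≤ A₁/2` once `log N > 3𝔖`. -/
theorem primeCellsRelative_false_without_nondegeneracy : ¬ PrimeCellsRelativeWithoutNondegeneracy :=
  Negative.primeCellsRelative_false_without_nondegeneracy

/-! ### Box containment `K ⊆ [-N, N]` -/

/-- `PrimeCellsRelative` with `K ⊆ realBox 1 N` deleted. FALSE:
`primeCellsRelative_false_without_boxContainment`. -/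
def PrimeCellsRelativeWithoutBoxContainment : Prop :=
  ∀ (t L : ℕ), 1 ≤ t → ∀ ε : ℝ, 0 < ε → ∃ u : ℕ, 2 ≤ u ∧ ∃ N₀ : ℕ, ∀ N : ℕ, N₀ ≤ N →
      ∀ Ψ : Fin t → Literature.NumberTheory.Sieve.AffLinForm 1,
        Literature.NumberTheory.Sieve.IsNondegenerateSystem Ψ →
        Literature.NumberTheory.Sieve.affLinSize Ψ N ≤ L →
        ∀ K : Set (Fin 1 → ℝ), Convex ℝ K →
          |((((Literature.NumberTheory.Sieve.latticeBox 1 N).filter (fun n =>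
              Literature.NumberTheory.Sieve.realPoint n ∈ K ∧ ∀ i, (N : ℝ) ^ ((1 : ℝ) / u) <
                (Nat.minFac ((Ψ i).eval n).toNat : ℝ) ∧
                ArithmeticFunction.cardFactors ((Ψ i).eval n).toNat = 1)).card : ℕ) : ℝ) -
            Literature.NumberTheory.Sieve.archFactor Ψ K *
              Literature.NumberTheory.Sieve.singularProduct Ψ *
              (((((Finset.Icc 1 N).filter (fun m => (N : ℝ) ^ ((1 : ℝ) / u) < (Nat.minFac m : ℝ) ∧
                ArithmeticFunction.cardFactors m = 1)).card : ℕ) : ℝ) / N) ^ t| ≤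
          ε * (Literature.NumberTheory.Sieve.archFactor Ψ K *
              Literature.NumberTheory.Sieve.singularProduct Ψ *
              (((((Finset.Icc 1 N).filter (fun m => (N : ℝ) ^ ((1 : ℝ) / u) < (Nat.minFac m : ℝ) ∧
                ArithmeticFunction.cardFactors m = 1)).card : ℕ) : ℝ) / N) ^ t + N / Real.log N ^ t)

/-- **The normalisation `β_∞ = vol(K ∩ [-N,N] ∩ {ψᵢ > 0})` is pinned** (LANDED:
`Negative/FalseWithoutBoxContainment.lean`, p100396): `ψ(n) = n`, `K = [2N, 10N]`: count `0`,
`β_∞ = 8N`. -/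
theorem primeCellsRelative_false_without_boxContainment : ¬ PrimeCellsRelativeWithoutBoxContainment :=
  Negative.primeCellsRelative_false_without_boxContainment

/-! ### Convexity of `K` -/

/-- `PrimeCellsRelative` with `Convex ℝ K` deleted. FALSE (punctured box):
`primeCellsRelative_false_without_convexity`. -/
def PrimeCellsRelativeWithoutConvexity : Prop :=
  ∀ (t L : ℕ), 1 ≤ t → ∀ ε : ℝ, 0 < ε → ∃ u : ℕ, 2 ≤ u ∧ ∃ N₀ : ℕ, ∀ N : ℕ, N₀ ≤ N →
      ∀ Ψ : Fin t → Literature.NumberTheory.Sieve.AffLinForm 1,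
        Literature.NumberTheory.Sieve.IsNondegenerateSystem Ψ →
        Literature.NumberTheory.Sieve.affLinSize Ψ N ≤ L →
        ∀ K : Set (Fin 1 → ℝ), K ⊆ Literature.NumberTheory.Sieve.realBox 1 N →
          |((((Literature.NumberTheory.Sieve.latticeBox 1 N).filter (fun n =>
              Literature.NumberTheory.Sieve.realPoint n ∈ K ∧ ∀ i, (N : ℝ) ^ ((1 : ℝ) / u) <
                (Nat.minFac ((Ψ i).eval n).toNat : ℝ) ∧
                ArithmeticFunction.cardFactors ((Ψ i).eval n).toNat = 1)).card : ℕ) : ℝ) -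
            Literature.NumberTheory.Sieve.archFactor Ψ K *
              Literature.NumberTheory.Sieve.singularProduct Ψ *
              (((((Finset.Icc 1 N).filter (fun m => (N : ℝ) ^ ((1 : ℝ) / u) < (Nat.minFac m : ℝ) ∧
                ArithmeticFunction.cardFactors m = 1)).card : ℕ) : ℝ) / N) ^ t| ≤
          ε * (Literature.NumberTheory.Sieve.archFactor Ψ K *
              Literature.NumberTheory.Sieve.singularProduct Ψ *
              (((((Finset.Icc 1 N).filter (fun m => (N : ℝ) ^ ((1 : ℝ) / u) < (Nat.minFac m : ℝ) ∧
                ArithmeticFunction.cardFactors m = 1)).card : ℕ) : ℝ) / N) ^ t + N / Real.log N ^ t)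

/-- **Any proof must use convexity (boundedly many intervals)** (LANDED:
`Negative/FalseWithoutConvexity.lean`, p100495): `ψ(n) = n`, `K = [-N, N] ∖ {prime points}`: count `0`,
`β_∞ = N`. -/
theorem primeCellsRelative_false_without_convexity : ¬ PrimeCellsRelativeWithoutConvexity :=
  Negative.primeCellsRelative_false_without_convexity

/-! ## (b) Slack: the `t = 0` slice is TRUE (`1 ≤ t` is cosmetic) -/

/-- `PrimeCellsRelative` at `t = 0` (the guard `1 ≤ t` deleted and `t` specialised to `0`). TRUE:
`primeCellsRelative_at_zero`. -/
def PrimeCellsRelativeAtZero : Prop :=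
  ∀ L : ℕ, ∀ ε : ℝ, 0 < ε → ∃ u : ℕ, 2 ≤ u ∧ ∃ N₀ : ℕ, ∀ N : ℕ, N₀ ≤ N →
      ∀ Ψ : Fin 0 → Literature.NumberTheory.Sieve.AffLinForm 1,
        Literature.NumberTheory.Sieve.IsNondegenerateSystem Ψ →
        Literature.NumberTheory.Sieve.affLinSize Ψ N ≤ L →
        ∀ K : Set (Fin 1 → ℝ), Convex ℝ K → K ⊆ Literature.NumberTheory.Sieve.realBox 1 N →
          |((((Literature.NumberTheory.Sieve.latticeBox 1 N).filter (fun n =>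
              Literature.NumberTheory.Sieve.realPoint n ∈ K ∧ ∀ i, (N : ℝ) ^ ((1 : ℝ) / u) <
                (Nat.minFac ((Ψ i).eval n).toNat : ℝ) ∧
                ArithmeticFunction.cardFactors ((Ψ i).eval n).toNat = 1)).card : ℕ) : ℝ) -
            Literature.NumberTheory.Sieve.archFactor Ψ K *
              Literature.NumberTheory.Sieve.singularProduct Ψ *
              (((((Finset.Icc 1 N).filter (fun m => (N : ℝ) ^ ((1 : ℝ) / u) < (Nat.minFac m : ℝ) ∧
                ArithmeticFunction.cardFactors m = 1)).card : ℕ) : ℝ) / N) ^ 0| ≤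
          ε * (Literature.NumberTheory.Sieve.archFactor Ψ K *
              Literature.NumberTheory.Sieve.singularProduct Ψ *
              (((((Finset.Icc 1 N).filter (fun m => (N : ℝ) ^ ((1 : ℝ) / u) < (Nat.minFac m : ℝ) ∧
                ArithmeticFunction.cardFactors m = 1)).card : ℕ) : ℝ) / N) ^ 0 + N / Real.log N ^ 0)

/-- **The `t = 0` slice holds** (LANDED: `Negative/SlackAtZero.lean`, p100967): lattice points of an interval
versus its length, `𝔖(∅) = 1`, `β_∞(∅, K) = vol K`; so any counterexample to the crux has `t ≥ 2`. -/
theorem primeCellsRelative_at_zero : PrimeCellsRelativeAtZero :=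
  Negative.primeCellsRelative_at_zero

/-! ## (e) The conditional negative in print (re-export, not a near-miss) -/

/-- **Siegel zeros would kill the crux** (contrapositive of the landed guard
`Cruxes.PrimeCellsRelative.Sketch.primeCellsRelative_not_unboundedSiegelZeros`, p96058): modulo the
vendored theorem of Matomäki–Merikoski (IMRN 2023, Thm 1.3), Siegel zeros of unbounded quality make
`PrimeCellsRelative` false. Not filed `--negative-modulo`: the hypothesis is believed false.
[cite: MatomakiMerikoski2023, Thm 1.3] -/
theorem primeCellsRelative_false_of_unboundedSiegelZeros
    (hMM : Literature.Barriers.Parity.MatomakiMerikoski2023_pairCorrelation)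
    (hZ : Literature.Barriers.Parity.UnboundedSiegelZeros) : ¬ PrimeCellsRelative :=
  fun h => Cruxes.PrimeCellsRelative.Sketch.primeCellsRelative_not_unboundedSiegelZeros hMM h hZ

end Summit.Parity.GeneralizedHardyLittlewood.Cruxes.PrimeCellsRelative.Disproof

end
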